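import Summits.Langlands.Langlands.Theorems.IrreducibilityBySelfDualityIrreducibleOffSectorMonomialInduced
import Summits.Langlands.Langlands.Theorems.IrreducibilityBySelfDualityIrreducibleOffSectorTransfer
import Summits.Langlands.Langlands.Theorems.QuadraticWindowHostInducedRepSignedTwistAux
import Summits.Langlands.Langlands.Theorems.QuadraticWindowHostInducedRepInducedCharpoly
import Literature.NumberTheory.Automorphic.AshSmithTheoryHeckeProofs
import Literature.NumberTheory.Automorphic.ReciprocityGLnDescentProofs
import Literature.NumberTheory.Automorphic.TunnellOctahedralGlobal
import Literature.NumberTheory.GaloisRepresentations.FrobeniusPlaces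
import Literature.NumberTheory.GaloisRepresentations.GaloisRepFrobeniusProofs
import HarnessLib

/-!
# The MONOMIAL (CM-type) region of `IrreducibleOffSector`
(crux stmt-Langlands-14329 `IrreducibilityBySelfDuality.IrreducibleOffSector`, line `Sketch`;
`--supports` file, continuation lead c4; sequel of `…IrreducibleOffSectorMonomialInduced`, p121576)

**Theorem** (`isIrreducible_of_isAutomorphicInductionAlong_one`, unconditional, every rank,
every number field, regular or not).  Let `E/K` be a finite Galois extension of number fields,
`τ` an automorphic representation datum of `GL_1(𝔸_E)` and `P` one of `GL_n(𝔸_K)` which is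
automorphically induced from `τ` (`IsAutomorphicInductionAlong τ P`, Arthur–Clozel Ch. 3 Def. 6.1:
`det(X - t_{P,v}) = ∏_{w ∣ v} (X^{f(w|v)} - t_{τ,w})` for almost all `v`).  Assume
* `τ` is **Galois-regular**: for every `g ≠ 1` in `Gal(E/K)` it is NOT the case that
  `t_{τ, g w} = t_{τ, w}` for almost all `w` (Arthur–Clozel's cuspidality criterion, Lemma 6.4;
  for `P` CUSPIDAL this holds by their Cor. 6.5 =
  `IsAutomorphicInductionAlong.not_eventually_hasSatakeParamAt_smul_of_cuspidal`, granted
  Jacquet–Shalika), and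
* `τ` has an `ℓ`-adic avatar `ψ : Γ_E → GL_1(ℚ̄_ℓ)` along `ι` (`SatakeFrobCompatibleAt ι τ ψ w`
  for almost all `w`; by Weil this is the case iff `τ` is L-algebraic = of type `A₀`).
Then EVERY `ρ : Γ_K → GL_n(ℚ̄_ℓ)` Satake–Frobenius compatible with `(P, ι)` at almost every place
is irreducible.

Proof.  `ρ₀ := Ind_{Γ_E}^{Γ_K} ψ` (tree: `FramedGaloisRep.induce`, relabelled to rank `n`) is
(1) Satake–Frobenius compatible with `P` almost everywhere
(`eventually_satakeFrobCompatibleAt_induce`): at a place `v` unramified in `E` above which `ψ`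
is unramified and compatible with `τ`, `Ind ψ` is unramified (`FramedGaloisRep.isUnramifiedAt_induce`,
`inertia_le_range_absGaloisRestrict`) with Frobenius polynomial
`∏_{w ∣ v} P_w(X^{f(w|v)})`, `P_w = arithFrobPolyOfSatake ι q_w 1 t_{τ,w}`
(`exists_charpoly_induce_eq_prod_expand`), and this "host polynomial" is
`arithFrobPolyOfSatake ι q_v 1 t_{P,v}` by the automorphic-induction relation
(`hostPoly_eq_arithFrobPolyOfSatake`, p-item QuadraticWindow); (2) irreducible
(`isIrreducible_induce_of_outerConj_ne`, Mackey for characters), because the conjugates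
`ψ^{r_i⁻¹}` are pairwise distinct (`outerConj_ne_of_satakeRegular`): if `ψ^a = ψ^b` for `a, b`
in distinct cosets of `res(Γ_E)`, the Frobenius dictionary `hasFrobCharpolyAt_outerConj_iff` and
the uniqueness of Satake parameters and Frobenius polynomials give `t_{τ, g w} = t_{τ, w}` a.e.
for `g = ā b̄⁻¹ ≠ 1`.  Then the Chebotarev–Brauer–Nesbitt transfer
`isIrreducible_of_satakeFrobCompatible` (p79199) concludes.

This is the region of the automorphic representations of CM / monomial type: in rank `2` the
cuspidal `π(χ)` attached to an algebraic Hecke character `χ ≠ χ^c` of a quadratic extension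
(including the IRREGULAR ones — partial weight one Hilbert CM forms over totally real `K` — that
are not of Galois type and so lie outside the Galois-type region `…ArtinType` and outside every
regular region of the c2 map), and in rank `d` the `AI_{E/K}(χ)` of type-`A₀` characters (the
Galois representations of CM motives).  No reciprocity input (items 14328/13622, JS (2.3)) is used.

References: J. Arthur, L. Clozel, *Simple algebras, base change, and the advanced theory of the
trace formula* (1989), Ch. 3 §6, Def. 6.1, Lemma 6.4, Cor. 6.5; J.-P. Serre, *Linear
representations of finite groups* (1977), §7.3–7.4; J.-P. Serre, *Abelian ℓ-adic representations*
(1968), Ch. I §2; A. Weil, *On a certain type of characters of the idèle-class group* (1956).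
-/

noncomputable section

set_option linter.dupNamespace false

open scoped NumberField Classical Matrix Polynomial
open Filter IsDedekindDomain Polynomial
open Literature.NumberTheory.Automorphic Literature.NumberTheory.GaloisRepresentations
open Summit.Langlands
open Summit.Langlands.Langlands.Theorems.HostInducedRep.GrsExplicitDescent (hostPoly
  hostPoly_eq_arithFrobPolyOfSatake finite_fibre setOf_asIdeal_under_eq)
open Summit.Langlands.Langlands.Theorems.HostInducedRep.OneTransparentPane
  (exists_charpoly_induce_eq_prod_expand)

namespace Summit.Langlands.Langlands.Theorems.IrreducibleOffSector

/-! ## 1. The induced Frobenius package at a place unramified in `E/K` -/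

section Package

variable (K : Type) {E : Type} [Field K] [NumberField K] [Field E] [NumberField E] [Algebra K E]
  [IsGalois K E] {A : Type} [CommRing A] [TopologicalSpace A] {d m : ℕ}

/-- **The Frobenius package of `Ind_{Γ_E}^{Γ_K} ρ` at a place `v` unramified in `E`** (every
rank, fact-free): if `v.asIdeal.ramificationIdxIn (𝓞 E) = 1` and `ρ : Γ_E → GL_m(A)` is
unramified with Frobenius characteristic polynomial `P_w` at every place `w ∣ v` of `E`, then
`Ind ρ` is unramified at `v` with Frobenius characteristic polynomial `∏_{w ∣ v} P_w(X^{f(w|v)})`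
(`inertia_le_range_absGaloisRestrict`, `FramedGaloisRep.isUnramifiedAt_induce`,
`exists_charpoly_induce_eq_prod_expand`; the bookkeeping `∏ w : {w // w ∣ v}` versus
`∏ᶠ w ∈ {w ∣ v}` is adapted from `HostInducedRep.OneTransparentPane.exists_semisimple_induce_package`).
Serre, *Linear representations of finite groups*, §3.3, §7.3; Neukirch, *Algebraic Number Theory*,
VII §10 (10.4). [folklore] -/
theorem isUnramifiedAt_and_hasFrobCharpolyAt_induce (hd : Module.finrank K E = d)
    (ρ : FramedGaloisRep E A m) {v : HeightOneSpectrum (𝓞 K)}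
    (he : v.asIdeal.ramificationIdxIn (𝓞 E) = 1) (P : HeightOneSpectrum (𝓞 E) → A[X])
    (hρ : ∀ w : HeightOneSpectrum (𝓞 E), w.asIdeal.under (𝓞 K) = v.asIdeal →
      ρ.IsUnramifiedAt w ∧ ρ.HasFrobCharpolyAt w (P w)) :
    (ρ.induce K hd).IsUnramifiedAt v ∧ (ρ.induce K hd).HasFrobCharpolyAt v
      (∏ᶠ w ∈ {w : HeightOneSpectrum (𝓞 E) | w.under (𝓞 K) = v},
        expand A (w.asIdeal.inertiaDeg (𝓞 K)) (P w)) := by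
  classical
  haveI : FiniteDimensional K E := Module.Finite.of_restrictScalars_finite ℚ K E
  have hIn : ∀ 𝔓 ∈ v.primesAbove,
      𝔓.inertia (Field.absoluteGaloisGroup K) ≤ (absGaloisRestrict K E).range :=
    fun 𝔓 h𝔓 ↦ inertia_le_range_absGaloisRestrict K E he h𝔓
  have hIunr : (ρ.induce K hd).IsUnramifiedAt v :=
    FramedGaloisRep.isUnramifiedAt_induce K hd ρ hIn fun w hw ↦ (hρ w hw).1
  refine ⟨hIunr, fun 𝔓 h𝔓 σ hσ ↦ ?_⟩
  have hfin : {w : HeightOneSpectrum (𝓞 E) | w.under (𝓞 K) = v}.Finite := finite_fibre v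
  haveI : Fintype {w : HeightOneSpectrum (𝓞 E) // w.under (𝓞 K) = v} := hfin.fintype
  obtain ⟨𝔔, s, hs, hchar⟩ :=
    exists_charpoly_induce_eq_prod_expand (K := K) hd ρ h𝔓 (hIn 𝔓 h𝔓) hσ
  rw [hchar]
  have hfac : ∀ w : {w : HeightOneSpectrum (𝓞 E) // w.under (𝓞 K) = v},
      expand A (w.1.asIdeal.inertiaDeg (𝓞 K)) (FramedRep.charpoly ρ (s w)) =
        expand A (w.1.asIdeal.inertiaDeg (𝓞 K)) (P w.1) := fun w ↦ by
    have hw : w.1.asIdeal.under (𝓞 K) = v.asIdeal := by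
      rw [← HeightOneSpectrum.under_asIdeal, w.2]
    rw [(hρ w.1 hw).2 (𝔔 w) (hs w).1 (s w) (hs w).2]
  rw [Fintype.prod_congr _ _ hfac, finprod_mem_eq_finite_toFinset_prod _ hfin]
  exact (Finset.prod_subtype (p := fun w : HeightOneSpectrum (𝓞 E) ↦ w.under (𝓞 K) = v)
    hfin.toFinset (fun x ↦ by exact hfin.mem_toFinset)
    fun w ↦ expand A (w.asIdeal.inertiaDeg (𝓞 K)) (P w)).symm

end Package

/-! ## 2. `Ind ψ` is Satake–Frobenius compatible with the automorphic induction `P` a.e. -/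

section Compat

variable {K E : Type} [Field K] [NumberField K] [Field E] [NumberField E] [Algebra K E]
  [IsGalois K E] {n ℓ : ℕ} [Fact ℓ.Prime] {hK : isCompact_glFiniteIntegralLevel n K}
  {h1 : isCompact_glFiniteIntegralLevel 1 E}

/-- With `m = 1` the Frobenius polynomial `arithFrobPolyOfSatake ι q 1 α = ∏_{a ∈ α} (X - ι⁻¹(a⁻¹))`
does not depend on `q`. [folklore] -/
theorem arithFrobPolyOfSatake_one_eq (ι : PadicAlgCl ℓ ≃+* ℂ) (q q' : ℕ) (α : Multiset ℂ) :
    arithFrobPolyOfSatake ι q 1 α = arithFrobPolyOfSatake ι q' 1 α := by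
  rw [arithFrobPolyOfSatake_one, arithFrobPolyOfSatake_one]

/-- `arithFrobPolyOfSatake ι q 1 ·` is injective on multisets (its roots are the `ι⁻¹(a⁻¹)`,
and `a ↦ ι⁻¹(a⁻¹)` is injective on `ℂ`). [folklore] -/
theorem arithFrobPolyOfSatake_one_injective (ι : PadicAlgCl ℓ ≃+* ℂ) (q q' : ℕ) {α β : Multiset ℂ}
    (h : arithFrobPolyOfSatake ι q 1 α = arithFrobPolyOfSatake ι q' 1 β) : α = β := by
  have hr := congrArg Polynomial.roots h
  rw [roots_arithFrobPolyOfSatake, roots_arithFrobPolyOfSatake] at hr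
  simp only [pow_zero, one_mul, Nat.sub_self] at hr
  exact Multiset.map_injective (fun a b hab ↦ inv_injective (ι.symm.injective hab)) hr

/-- **`Ind_{Γ_E}^{Γ_K} ψ` is Satake–Frobenius compatible with `P = AI_{E/K}(τ)` almost everywhere**
(relabelled to the rank `n` of `P` along `e : Fin (d * 1) ≃ Fin n`).  At a place `v` of `K`
unramified in `E` (all but finitely many: `finite_setOf_not_isUnramifiedIn`), above which `ψ` is
unramified and compatible with `τ` (all but finitely many: `eventually_forall_under_eq`) and at
which the induction relation of `IsAutomorphicInductionAlong` holds, `Ind ψ` is unramified with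
Frobenius polynomial `∏_{w ∣ v} expand_{f(w|v)} arithFrobPolyOfSatake ι q_w 1 t_{τ,w}`
(`isUnramifiedAt_and_hasFrobCharpolyAt_induce`), which is `arithFrobPolyOfSatake ι q_v 1 t_{P,v}`
(`hostPoly_eq_arithFrobPolyOfSatake` with `n = 1`, trivial twist `c = 1`).
[cite: ArthurClozelAMS120, Ch. 3 Def. 6.1] -/
theorem eventually_satakeFrobCompatibleAt_induce (ι : PadicAlgCl ℓ ≃+* ℂ)
    (τ : AutomorphicRepData (AutomorphyDatum.gl 1 E h1))
    (P : AutomorphicRepData (AutomorphyDatum.gl n K hK)) (hAI : IsAutomorphicInductionAlong τ P)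
    (ψ : FramedGaloisRep E (PadicAlgCl ℓ) 1)
    (hψ : ∀ᶠ w : HeightOneSpectrum (𝓞 E) in cofinite, SatakeFrobCompatibleAt ι τ ψ w)
    {d : ℕ} (hd : Module.finrank K E = d) (e : Fin (d * 1) ≃ Fin n) :
    ∀ᶠ v : HeightOneSpectrum (𝓞 K) in cofinite,
      SatakeFrobCompatibleAt ι P (FramedRep.reindex e (ψ.induce K hd)) v := by
  classical
  -- the three cofinite sets of good places
  have hunr : ∀ᶠ v : HeightOneSpectrum (𝓞 K) in cofinite, v.asIdeal.ramificationIdxIn (𝓞 E) = 1 :=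
    (Filter.eventually_cofinite.2 (finite_setOf_not_isUnramifiedIn K E)).mono
      fun v hv ↦ ramificationIdxIn_eq_one_of_isUnramifiedIn hv
  have habove := eventually_forall_under_eq (F := K) hψ
  filter_upwards [hunr, habove, hAI] with v hv hgood hind
  -- the Satake parameters `β w = t_{τ,w}` above `v`, with the compatibility of `ψ`
  have hβex : ∀ w : HeightOneSpectrum (𝓞 E), ∃ β : Multiset ℂ, w.asIdeal.under (𝓞 K) = v.asIdeal →
      τ.HasSatakeParamAt w β ∧ ψ.IsUnramifiedAt w ∧
        ψ.HasFrobCharpolyAt w (arithFrobPolyOfSatake ι w.residueCard 1 β) := by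
    intro w
    by_cases hw : w.asIdeal.under (𝓞 K) = v.asIdeal
    · obtain ⟨β, hβ⟩ := hgood w hw
      exact ⟨β, fun _ ↦ hβ⟩
    · exact ⟨∅, fun h ↦ absurd h hw⟩
  choose β hβ using hβex
  -- the induced Satake parameter `α = t_{P,v}`
  obtain ⟨α, hPα, hpoly⟩ := hind β fun w hw ↦ (hβ w hw).1
  -- the Galois side: the Frobenius package of `Ind ψ` at `v`
  obtain ⟨hIunr, hIchar⟩ := isUnramifiedAt_and_hasFrobCharpolyAt_induce K hd ψ hv
    (fun w ↦ arithFrobPolyOfSatake ι w.residueCard 1 (β w)) fun w hw ↦ (hβ w hw).2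
  -- the host polynomial is the Frobenius polynomial of the induced Satake parameter
  have htwist : (fun w : HeightOneSpectrum (𝓞 E) ↦ (β w).map (fun a ↦ a * (1 : ℂ))) = β := by
    funext w
    rw [show (fun a : ℂ ↦ a * 1) = id from funext fun a ↦ mul_one a, Multiset.map_id]
  have hhost : hostPoly ι 1 β (fun _ ↦ (1 : ℂ)) v = arithFrobPolyOfSatake ι v.residueCard 1 α :=
    hostPoly_eq_arithFrobPolyOfSatake ι 1 β (fun _ ↦ 1) v α (by rw [htwist]; exact hpoly)
  have hhost' : hostPoly ι 1 β (fun _ ↦ (1 : ℂ)) v =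
      ∏ᶠ w ∈ {w : HeightOneSpectrum (𝓞 E) | w.under (𝓞 K) = v},
        expand (PadicAlgCl ℓ) (w.asIdeal.inertiaDeg (𝓞 K))
          (arithFrobPolyOfSatake ι w.residueCard 1 (β w)) := by
    rw [hostPoly]
    exact finprod_mem_congr rfl fun w _ ↦ by rw [congrFun htwist w]
  refine ⟨α, hPα, (FramedGaloisRep.isUnramifiedAt_reindex_iff v e _).2 hIunr,
    (FramedGaloisRep.hasFrobCharpolyAt_reindex_iff v e _ _).2 ?_⟩
  rw [← hhost, hhost']
  exact hIchar

end Compat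

/-! ## 3. Galois-regularity of `τ` makes the conjugates of `ψ` pairwise distinct -/

section Regular

variable {K E : Type} [Field K] [NumberField K] [Field E] [NumberField E] [Algebra K E]
  [IsGalois K E] {ℓ : ℕ} [Fact ℓ.Prime] {h1 : isCompact_glFiniteIntegralLevel 1 E}

omit [NumberField K] in
/-- **A conjugate `ψ^a` of the avatar is the avatar of `τ ∘ ā`**: if `ψ` is Satake–Frobenius
compatible with `τ` at almost every `w`, then for `a ∈ Γ_K` the conjugate `ψ^a`
(`FramedGaloisRep.outerConj`) satisfies, for almost every `w`: for every Satake parameter `α` of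
`τ` at `ā • w`, `ψ^a` is unramified at `w` with Frobenius polynomial
`arithFrobPolyOfSatake ι q_w 1 α` (`isUnramifiedAt_outerConj_iff`, `hasFrobCharpolyAt_outerConj_iff`,
uniqueness of Satake parameters; `q` is irrelevant for `m = 1`). [folklore] -/
theorem eventually_outerConj_compatible (ι : PadicAlgCl ℓ ≃+* ℂ)
    (τ : AutomorphicRepData (AutomorphyDatum.gl 1 E h1)) (ψ : FramedGaloisRep E (PadicAlgCl ℓ) 1)
    (hψ : ∀ᶠ w : HeightOneSpectrum (𝓞 E) in cofinite, SatakeFrobCompatibleAt ι τ ψ w)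
    (a : Field.absoluteGaloisGroup K) :
    ∀ᶠ w : HeightOneSpectrum (𝓞 E) in cofinite, ∀ α : Multiset ℂ,
      τ.HasSatakeParamAt (absGaloisQuot K E a • w) α →
        (ψ.outerConj a).IsUnramifiedAt w ∧
          (ψ.outerConj a).HasFrobCharpolyAt w (arithFrobPolyOfSatake ι w.residueCard 1 α) := by
  have hinj : Function.Injective fun w : HeightOneSpectrum (𝓞 E) ↦ absGaloisQuot K E a • w :=
    MulAction.injective _
  filter_upwards [hinj.tendsto_cofinite.eventually hψ] with w hw α hα
  obtain ⟨α', hα', hunr, hchar⟩ := hw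
  have hαα : α' = α := τ.hasSatakeParamAt_unique_holds hα' hα
  subst hαα
  exact ⟨(FramedGaloisRep.isUnramifiedAt_outerConj_iff a ψ w).2 hunr,
    (FramedGaloisRep.hasFrobCharpolyAt_outerConj_iff a ψ w _).2
      (by rw [arithFrobPolyOfSatake_one_eq ι w.residueCard (absGaloisQuot K E a • w).residueCard]
          exact hchar)⟩

omit [NumberField E] in
/-- Distinct coset representatives `r_i ≠ r_j` of `Γ_K / res(Γ_E)` have `r_i⁻¹ r_j ∉ res(Γ_E)`, so
the image of `r_i⁻¹ (r_j⁻¹)⁻¹ = r_i⁻¹ r_j` in `Gal(E/K)` is non-trivial (`absGaloisQuot_eq_one_iff`: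
the kernel of `Γ_K → Gal(E/K)` is `res(Γ_E)`). [folklore] -/
theorem absGaloisQuot_cosetRep_ne_one [FiniteDimensional K E] {d : ℕ} (hd : Module.finrank K E = d)
    {i j : Fin d} (hij : i ≠ j) :
    absGaloisQuot K E ((absGaloisCosetRep K E hd i)⁻¹ * ((absGaloisCosetRep K E hd j)⁻¹)⁻¹) ≠ 1 := by
  intro h1
  rw [absGaloisQuot_eq_one_iff, inv_inv] at h1
  apply hij
  apply (absGaloisCosetRep_bijective K E hd).1
  change ((absGaloisCosetRep K E hd i : Field.absoluteGaloisGroup K ⧸ (absGaloisRestrict K E).range)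
    = absGaloisCosetRep K E hd j)
  rw [QuotientGroup.eq]
  exact h1

/-- Uniqueness of the Frobenius characteristic polynomial of a framed representation at a place of
a number field (there is a prime above the place and an arithmetic Frobenius at it).
Serre, *Abelian ℓ-adic representations* (1968), Ch. I §2.1. [folklore] -/
theorem hasFrobCharpolyAt_unique_framed {A : Type*} [CommRing A] [TopologicalSpace A] {m : ℕ}
    {ρ : FramedGaloisRep E A m} {w : HeightOneSpectrum (𝓞 E)} {P Q : A[X]}
    (hP : ρ.HasFrobCharpolyAt w P) (hQ : ρ.HasFrobCharpolyAt w Q) : P = Q := by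
  obtain ⟨𝔓, h𝔓⟩ := HeightOneSpectrum.primesAbove_nonempty w
  obtain ⟨σ, hσ⟩ := HeightOneSpectrum.exists_isArithFrobAt_of_mem_primesAbove_holds h𝔓
  rw [← hP 𝔓 h𝔓 σ hσ, ← hQ 𝔓 h𝔓 σ hσ]

/-- **Galois-regular `τ` ⇒ the conjugates `ψ^{r_i⁻¹}` of its avatar are pairwise distinct.**
If for every `g ≠ 1` in `Gal(E/K)` it is false that `t_{τ, g w} = t_{τ, w}` for almost all `w`,
then for coset representatives `r_i ≠ r_j` of `Γ_K / res(Γ_E)` the characters `ψ^{r_i⁻¹}`,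
`ψ^{r_j⁻¹}` differ somewhere.  For if `ψ^a = ψ^b` with `g := ā b̄⁻¹ ≠ 1`
(`absGaloisQuot_eq_one_iff`: the kernel of `Γ_K → Gal(E/K)` is `res(Γ_E)`), then at almost every
`w`, a Satake parameter `α` of `τ` at `w` gives `ψ^b = ψ^a` the Frobenius polynomial
`arithFrobPolyOfSatake ι q 1 α` at `b̄⁻¹ • w` (`eventually_outerConj_compatible` for `b`), hence `ψ^a`
has it there, i.e. `τ`'s parameter `α'` at `ā b̄⁻¹ • w` has the same Frobenius polynomial
(uniqueness of Frobenius polynomials at an unramified place, `HasFrobCharpolyAt.unique_holds`), so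
`α' = α` (`arithFrobPolyOfSatake_one_injective`) and `t_{τ, g w} = t_{τ, w}`.
[cite: ArthurClozelAMS120, Ch. 3 Lemma 6.4] -/
theorem outerConj_ne_of_satakeRegular {d : ℕ} (hd : Module.finrank K E = d) (ι : PadicAlgCl ℓ ≃+* ℂ)
    (τ : AutomorphicRepData (AutomorphyDatum.gl 1 E h1)) (ψ : FramedGaloisRep E (PadicAlgCl ℓ) 1)
    (hψ : ∀ᶠ w : HeightOneSpectrum (𝓞 E) in cofinite, SatakeFrobCompatibleAt ι τ ψ w)
    (hreg : ∀ g : E ≃ₐ[K] E, g ≠ 1 →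
      ¬ ∀ᶠ w : HeightOneSpectrum (𝓞 E) in cofinite, ∀ α : Multiset ℂ,
          τ.HasSatakeParamAt w α → τ.HasSatakeParamAt (g • w) α) :
    ∀ i j : Fin d, i ≠ j → ∃ σ : Field.absoluteGaloisGroup E,
      ψ.outerConj (absGaloisCosetRep K E hd i)⁻¹ σ ≠ ψ.outerConj (absGaloisCosetRep K E hd j)⁻¹ σ := by
  haveI : FiniteDimensional K E := Module.Finite.of_restrictScalars_finite ℚ K E
  intro i j hij
  by_contra hcon
  rw [not_exists] at hcon
  simp only [not_not] at hcon
  have hab : ψ.outerConj (absGaloisCosetRep K E hd i)⁻¹ = ψ.outerConj (absGaloisCosetRep K E hd j)⁻¹ :=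
    ContinuousMonoidHom.ext hcon
  -- `a = r_i⁻¹`, `b = r_j⁻¹`, `g = ā b̄⁻¹ ≠ 1`
  obtain ⟨a, ha⟩ : ∃ a, a = (absGaloisCosetRep K E hd i)⁻¹ := ⟨_, rfl⟩
  obtain ⟨b, hb⟩ : ∃ b, b = (absGaloisCosetRep K E hd j)⁻¹ := ⟨_, rfl⟩
  have hg1 : absGaloisQuot K E (a * b⁻¹) ≠ 1 := by
    rw [ha, hb]; exact absGaloisQuot_cosetRep_ne_one hd hij
  rw [← ha, ← hb] at hab
  refine hreg (absGaloisQuot K E (a * b⁻¹)) hg1 ?_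
  -- compatibility of `ψ` at `g • w`, and of `ψ^b` at `b̄⁻¹ • w`
  have hb' := eventually_outerConj_compatible ι τ ψ hψ b
  have hinj : Function.Injective fun w : HeightOneSpectrum (𝓞 E) ↦ (absGaloisQuot K E b)⁻¹ • w :=
    MulAction.injective _
  have hginj : Function.Injective fun w : HeightOneSpectrum (𝓞 E) ↦ absGaloisQuot K E (a * b⁻¹) • w :=
    MulAction.injective _
  filter_upwards [hinj.tendsto_cofinite.eventually hb', hginj.tendsto_cofinite.eventually hψ]
    with w hwb hwg α hα
  -- `ψ^b` has Frobenius polynomial `arith α` at `b̄⁻¹ • w` (`α` the Satake parameter of `τ` at `w`)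
  have h1 := hwb α (by rwa [smul_inv_smul])
  -- hence so has `ψ^a = ψ^b`, i.e. `ψ` at `ā • b̄⁻¹ • w = g • w`
  rw [← hab] at h1
  -- (the residue cardinality in `arithFrobPolyOfSatake ι q 1 α` is irrelevant: normalise it to `q_w`
  -- BEFORE moving the place, so that no `q_{g • w}` versus `q_{g' • w}` comparison is left to
  -- definitional unfolding)
  have h2 : ψ.HasFrobCharpolyAt (absGaloisQuot K E (a * b⁻¹) • w)
      (arithFrobPolyOfSatake ι w.residueCard 1 α) := by
    have := (FramedGaloisRep.hasFrobCharpolyAt_outerConj_iff a ψ _ _).1 h1.2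
    rw [arithFrobPolyOfSatake_one_eq ι ((absGaloisQuot K E b)⁻¹ • w).residueCard w.residueCard,
      smul_smul, ← map_inv, ← map_mul] at this
    exact this
  -- compare with the compatibility of `ψ` at `g • w`
  obtain ⟨α', hα', -, hchar'⟩ := hwg
  rw [arithFrobPolyOfSatake_one_eq ι _ w.residueCard] at hchar'
  have hαα : α' = α :=
    arithFrobPolyOfSatake_one_injective ι _ _ (hasFrobCharpolyAt_unique_framed hchar' h2)
  rw [← hαα]
  exact hα'

end Regular

/-! ## 4. The monomial region -/

section Main

/-- **The MONOMIAL (CM-type) region of `IrreducibleOffSector`** (unconditional; every rank `n`,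
every number field `K`, regular or not).  Let `E/K` be finite Galois, `τ` an automorphic
representation datum of `GL_1(𝔸_E)`, `P` one of `GL_n(𝔸_K)` automatically induced from `τ`
(`IsAutomorphicInductionAlong τ P`: `det(X - t_{P,v}) = ∏_{w ∣ v} (X^{f(w|v)} - t_{τ,w})` a.e.,
Arthur–Clozel Ch. 3 Def. 6.1), `τ` Galois-regular (`t_{τ, g ·} ≠ t_{τ, ·}` on an infinite set for
each `g ≠ 1`; automatic for `P` cuspidal by Arthur–Clozel Cor. 6.5), and `ψ : Γ_E → GL_1(ℚ̄_ℓ)`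
an `ℓ`-adic avatar of `τ` along `ι` (Weil; exists iff `τ` is of type `A₀`).  Then every
`ρ : Γ_K → GL_n(ℚ̄_ℓ)` Satake–Frobenius compatible with `(P, ι)` almost everywhere is irreducible:
`ρ₀ = Ind_{Γ_E}^{Γ_K} ψ` is compatible with `P` a.e. (`eventually_satakeFrobCompatibleAt_induce`)
and irreducible by Mackey (`isIrreducible_induce_of_outerConj_ne`, `outerConj_ne_of_satakeRegular`),
and irreducibility transfers along a.e. Frobenius agreement by Chebotarev–Brauer–Nesbitt
(`isIrreducible_of_satakeFrobCompatible`, p79199).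
[cite: ArthurClozelAMS120, Ch. 3 Def. 6.1 and Lemma 6.4] [cite: SerreLinearRepresentations1977, §7.3 Prop. 22] -/
theorem isIrreducible_of_isAutomorphicInductionAlong_one {K E : Type} [Field K] [NumberField K]
    [Field E] [NumberField E] [Algebra K E] [IsGalois K E] {n ℓ : ℕ} [Fact ℓ.Prime]
    {hK : isCompact_glFiniteIntegralLevel n K} {h1 : isCompact_glFiniteIntegralLevel 1 E}
    (ι : PadicAlgCl ℓ ≃+* ℂ) (τ : AutomorphicRepData (AutomorphyDatum.gl 1 E h1))
    (P : AutomorphicRepData (AutomorphyDatum.gl n K hK)) (hAI : IsAutomorphicInductionAlong τ P)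
    (hreg : ∀ g : E ≃ₐ[K] E, g ≠ 1 →
      ¬ ∀ᶠ w : HeightOneSpectrum (𝓞 E) in cofinite, ∀ α : Multiset ℂ,
          τ.HasSatakeParamAt w α → τ.HasSatakeParamAt (g • w) α)
    (ψ : FramedGaloisRep E (PadicAlgCl ℓ) 1)
    (hψ : ∀ᶠ w : HeightOneSpectrum (𝓞 E) in cofinite, SatakeFrobCompatibleAt ι τ ψ w)
    (ρ : FramedGaloisRep K (PadicAlgCl ℓ) n)
    (hρ : ∀ᶠ v : HeightOneSpectrum (𝓞 K) in cofinite, SatakeFrobCompatibleAt ι P ρ v) :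
    ρ.toGaloisRep.IsIrreducible := by
  haveI : FiniteDimensional K E := Module.Finite.of_restrictScalars_finite ℚ K E
  haveI : CharZero E := charZero_of_injective_algebraMap (algebraMap K E).injective
  -- the rank: `n = 1 · [E : K]`
  set d := Module.finrank K E with hdd
  have hd : Module.finrank K E = d := rfl
  have hn : d * 1 = n := by rw [hAI.rank_eq, hdd]; ring
  let e : Fin (d * 1) ≃ Fin n := finCongr hn
  -- `ρ₀ = Ind ψ`, relabelled: compatible a.e. and irreducible
  have h₀ := eventually_satakeFrobCompatibleAt_induce ι τ P hAI ψ hψ hd e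
  have hirr : (ψ.induce K hd).toGaloisRep.IsIrreducible :=
    isIrreducible_induce_of_outerConj_ne K hd ψ (outerConj_ne_of_satakeRegular hd ι τ ψ hψ hreg)
  have hirr₀ : FramedGaloisRep.toGaloisRep (K := K)
      (FramedRep.reindex e (ψ.induce K hd)) |>.IsIrreducible :=
    isIrreducible_reindex e _ hirr
  exact isIrreducible_of_satakeFrobCompatible P ι hirr₀ h₀ hρ

end Main

end Summit.Langlands.Langlands.Theorems.IrreducibleOffSector

end
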